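import Mathlib
import HarnessLib
import Summits.NavierStokesRegularity.NavierStokesRegularity.Theorems.HardyPointSinkHardyAncientLimitGradient
import Literature.Analysis.FluidPDE.WholeSpaceIBP
import Literature.Analysis.FluidPDE.SpaceTimeCalculus
import Literature.Analysis.FluidPDE.ClassicalSolutionCalculus
import Literature.Analysis.FluidPDE.KNSSThm52Integrand
import Literature.Analysis.FluidPDE.TaoEnstrophyLocalisation

/-!
# Weak limits of the isobaric defect along time lines — crux stmt-NavierStokesRegularity-11739
# (`IsobarTomography.TubeAlternative`), line `analytic-propagation-local-patch`, registered
# sub-goal `stub_defectLineLimit` (helper of stub `stub_peakZoomPatch`)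

Helper file (theorems only) for the vorticity-scale zoom of the line. Along a `C¹_loc`-convergent
sequence of classical pairs `(w_j, q_j)` with KNSS's uniform bounds (Acta Math. 203 (2009) =
arXiv:0709.3599, Prop. 4.1 (4.10)–(4.11), Lemma 6.1) the isobaric defect
`⟪curl w_j, ∇q_j⟫ = ⟪curl w_j, Δw_j − (w_j·∇)w_j − ∂ₛw_j⟫` need not converge pointwise (only a
bound on `∂ₛw_j` is available), but its integrals along time lines do:
`tendsto_laplacian_of_tendsto_fderiv` (`Δw_j → ΔW`: Arzelà–Ascoli via the tree's
`HardyAncientLimit.tendsto_fderiv_of_equicontinuous`), `tendsto_intervalIntegral_inner_sub_deriv`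
(the time derivative is integrated by parts onto the fixed smooth factor), `stub_defectLineLimit`.
-/

-- the problem directory repeats the summit name (D-0017); core's `dupNamespace` linter fires
set_option linter.dupNamespace false

noncomputable section

namespace Summit.NavierStokesRegularity.NavierStokesRegularity.Theorems.TubeAlternative.AnalyticPropagation

open Set Filter Topology Function MeasureTheory Metric
open scoped RealInnerProductSpace NNReal ENNReal Laplacian ContDiff
open Literature.Analysis Literature.Analysis.FluidPDE
open Summit.NavierStokesRegularity.NavierStokesRegularity.Theorems

/-- `D(y ↦ Df(y) u)(y) h = D²f(y)[h, u]` for `f ∈ C²`. [folklore] -/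
theorem fderiv_fderiv_apply_const_apply {f : (EuclideanSpace ℝ (Fin 3)) → (EuclideanSpace ℝ (Fin 3))} (hf : ContDiff ℝ 2 f) (u y h : (EuclideanSpace ℝ (Fin 3))) :
    fderiv ℝ (fun y => fderiv ℝ f y u) y h = iteratedFDeriv ℝ 2 f y ![h, u] := by
  have hd : DifferentiableAt ℝ (fderiv ℝ f) y :=
    ((hf.fderiv_right (m := 1) le_rfl).differentiable one_ne_zero) y
  rw [iteratedFDeriv_two_apply, fderiv_clm_apply hd (differentiableAt_const _)]
  simp

/-- **Laplacians converge when gradients converge and `D²`, `D³` are bounded**: if `∇v_j → ∇V`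
pointwise, `v_j ∈ C³` with `‖D²v_j‖ ≤ K₂`, `‖D³v_j‖ ≤ K₃` eventually, and `V ∈ C²`, then
`Δv_j(x) → ΔV(x)` (each `∂ᵢ∂ᵢv_j` converges by `HardyAncientLimit.tendsto_fderiv_of_equicontinuous`:
Arzelà–Ascoli and uniqueness of the derivative). [folklore] -/
theorem tendsto_laplacian_of_tendsto_fderiv {v : ℕ → (EuclideanSpace ℝ (Fin 3)) → (EuclideanSpace ℝ (Fin 3))} {V : (EuclideanSpace ℝ (Fin 3)) → (EuclideanSpace ℝ (Fin 3))} {K₂ K₃ : ℝ}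
    (hv : ∀ᶠ j in atTop, ContDiff ℝ 3 (v j)) (hV : ContDiff ℝ 2 V)
    (hlim : ∀ y, Tendsto (fun j => fderiv ℝ (v j) y) atTop (𝓝 (fderiv ℝ V y)))
    (h2 : ∀ᶠ j in atTop, ∀ y, ‖iteratedFDeriv ℝ 2 (v j) y‖ ≤ K₂)
    (h3 : ∀ᶠ j in atTop, ∀ y, ‖iteratedFDeriv ℝ 3 (v j) y‖ ≤ K₃) (x : (EuclideanSpace ℝ (Fin 3))) :
    Tendsto (fun j => (Δ (v j)) x) atTop (𝓝 ((Δ V) x)) := by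
  set b := EuclideanSpace.basisFun (Fin 3) ℝ with hb
  have hK₃ : 0 ≤ K₃ := by
    obtain ⟨j, hj⟩ := h3.exists
    exact (norm_nonneg _).trans (hj 0)
  have h32 : ∀ {f : (EuclideanSpace ℝ (Fin 3)) → (EuclideanSpace ℝ (Fin 3))}, ContDiff ℝ 3 f → ContDiff ℝ 2 f := fun hf => hf.of_le (by norm_num)
  -- one direction at a time
  have key : ∀ i, Tendsto (fun j => fderiv ℝ (fun y => fderiv ℝ (v j) y (b i)) x (b i)) atTop
      (𝓝 (fderiv ℝ (fun y => fderiv ℝ V y (b i)) x (b i))) := by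
    intro i
    have hbi : ‖b i‖ = 1 := b.norm_eq_one i
    have hdir : ∀ {f : (EuclideanSpace ℝ (Fin 3)) → (EuclideanSpace ℝ (Fin 3))}, ContDiff ℝ 3 f → ContDiff ℝ 2 (fun y => fderiv ℝ f y (b i)) :=
      fun hf => (hf.fderiv_right (m := 2) le_rfl).clm_apply contDiff_const
    have H := HardyAncientLimit.tendsto_fderiv_of_equicontinuous
      (f := fun j y => fderiv ℝ (v j) y (b i)) (g := fun y => fderiv ℝ V y (b i)) (x := x)
      one_pos ?_ ?_ ?_ (B := K₂) hK₃ one_pos ?_ ?_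
    · exact ((ContinuousLinearMap.apply ℝ (EuclideanSpace ℝ (Fin 3)) (b i)).continuous.tendsto _).comp H.2
    · filter_upwards [hv] with j hj
      exact fun y _ => ((hdir hj).differentiable (by norm_num)) y
    · filter_upwards [hv] with j hj
      exact ((hdir hj).continuous_fderiv (by norm_num)).continuousOn
    · exact fun y _ => ((ContinuousLinearMap.apply ℝ (EuclideanSpace ℝ (Fin 3)) (b i)).continuous.tendsto _).comp (hlim y)
    · filter_upwards [hv, h2] with j hj hj2
      intro y _
      refine ContinuousLinearMap.opNorm_le_bound _ ((norm_nonneg _).trans (hj2 y)) fun h => ?_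
      rw [fderiv_fderiv_apply_const_apply (h32 hj)]
      refine (ContinuousMultilinearMap.le_opNorm _ _).trans ?_
      rw [Fin.prod_univ_two]
      show ‖iteratedFDeriv ℝ 2 (v j) y‖ * (‖h‖ * ‖b i‖) ≤ K₂ * ‖h‖
      rw [hbi, mul_one]
      exact mul_le_mul_of_nonneg_right (hj2 y) (norm_nonneg _)
    · filter_upwards [hv, h3] with j hj hj3
      intro y _ y' _
      rw [Real.rpow_one, dist_eq_norm, dist_eq_norm]
      -- `D²v_j` is `K₃`-Lipschitz
      have hlip : ‖iteratedFDeriv ℝ 2 (v j) y - iteratedFDeriv ℝ 2 (v j) y'‖ ≤ K₃ * ‖y - y'‖ :=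
        convex_univ.norm_image_sub_le_of_norm_fderiv_le
          (fun z _ => (hj.differentiable_iteratedFDeriv (m := 2) (by norm_cast)) z)
          (fun z _ => by rw [norm_fderiv_iteratedFDeriv]; exact hj3 z) (mem_univ y') (mem_univ y)
      refine ContinuousLinearMap.opNorm_le_bound _ (by positivity) fun h => ?_
      rw [_root_.sub_apply _ _ h, fderiv_fderiv_apply_const_apply (h32 hj),
        fderiv_fderiv_apply_const_apply (h32 hj)]
      rw [← _root_.sub_apply (iteratedFDeriv ℝ 2 (v j) y) _ ![h, b i]]
      refine (ContinuousMultilinearMap.le_opNorm _ _).trans ?_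
      rw [Fin.prod_univ_two]
      show _ * (‖h‖ * ‖b i‖) ≤ _
      rw [hbi, mul_one]
      exact mul_le_mul_of_nonneg_right hlip (norm_nonneg _)
  -- sum over the basis
  have hvj : ∀ᶠ j in atTop,
      ∑ i, fderiv ℝ (fun y => fderiv ℝ (v j) y (b i)) x (b i) = (Δ (v j)) x := by
    filter_upwards [hv] with j hj
    exact (laplacian_eq_sum_fderiv_fderiv b (h32 hj) x).symm
  rw [laplacian_eq_sum_fderiv_fderiv b hV x]
  exact (tendsto_finsetSum _ fun i _ => key i).congr' hvj

/-- **Integration by parts along a time line**: for `C, h : ℝ → ℝ³` of class `C¹` on `[σ₁, σ₂]`,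
`∫_{σ₁}^{σ₂} ⟪C, h'⟫ = ⟪C(σ₂), h(σ₂)⟫ − ⟪C(σ₁), h(σ₁)⟫ − ∫_{σ₁}^{σ₂} ⟪C', h⟫`. [folklore] -/
theorem intervalIntegral_inner_deriv_eq {σ₁ σ₂ : ℝ} (hσ : σ₁ ≤ σ₂) {C C' h h' : ℝ → (EuclideanSpace ℝ (Fin 3))}
    (hC : ∀ s ∈ Icc σ₁ σ₂, HasDerivAt C (C' s) s) (hCc : ContinuousOn C (Icc σ₁ σ₂))
    (hC'c : ContinuousOn C' (Icc σ₁ σ₂))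
    (hh : ∀ s ∈ Icc σ₁ σ₂, HasDerivAt h (h' s) s) (hhc : ContinuousOn h (Icc σ₁ σ₂))
    (hh'c : ContinuousOn h' (Icc σ₁ σ₂)) :
    ∫ s in σ₁..σ₂, ⟪C s, h' s⟫ = ⟪C σ₂, h σ₂⟫ - ⟪C σ₁, h σ₁⟫ - ∫ s in σ₁..σ₂, ⟪C' s, h s⟫ := by
  have hI : uIcc σ₁ σ₂ = Icc σ₁ σ₂ := uIcc_of_le hσ
  have hi1 : IntervalIntegrable (fun s => ⟪C s, h' s⟫) volume σ₁ σ₂ :=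
    ((ContinuousOn.inner hCc hh'c).mono (by rw [hI])).intervalIntegrable
  have hi2 : IntervalIntegrable (fun s => ⟪C' s, h s⟫) volume σ₁ σ₂ :=
    ((ContinuousOn.inner hC'c hhc).mono (by rw [hI])).intervalIntegrable
  have hderiv : ∀ s ∈ uIcc σ₁ σ₂,
      HasDerivAt (fun s => ⟪C s, h s⟫) (⟪C s, h' s⟫ + ⟪C' s, h s⟫) s := fun s hs => by
    rw [hI] at hs
    exact (hC s hs).inner ℝ (hh s hs)
  have key := intervalIntegral.integral_eq_sub_of_hasDerivAt hderiv (hi1.add hi2)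
  rw [intervalIntegral.integral_add hi1 hi2] at key
  linarith

/-- **Weak convergence of time derivatives along a time line.** On `[σ₁, σ₂]` let `g_k → f`,
`C_k → C`, `A_k → A` pointwise with `‖g_k‖ ≤ K_g`, `‖g_k'‖ ≤ L`, `‖C_k‖ ≤ K_C`, `‖A_k‖ ≤ K_A`, all
maps continuous and `C`, `f`, `g_k` of class `C¹`. Then `∫ ⟪C_k, A_k − g_k'⟫ → ∫ ⟪C, A − f'⟫`:
dominated convergence for `⟪C_k, A_k⟫`; for `⟪C_k, g_k'⟫` the derivative is moved onto the
fixed smooth factor `C` (integration by parts), then dominated convergence again. [folklore] -/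
theorem tendsto_intervalIntegral_inner_sub_deriv {σ₁ σ₂ : ℝ} (hσ : σ₁ ≤ σ₂)
    {C C' f f' A : ℝ → (EuclideanSpace ℝ (Fin 3))} {Ck Ak g g' : ℕ → ℝ → (EuclideanSpace ℝ (Fin 3))} {KC KA Kg L : ℝ}
    (hC : ∀ s ∈ Icc σ₁ σ₂, HasDerivAt C (C' s) s) (hCc : ContinuousOn C (Icc σ₁ σ₂))
    (hC'c : ContinuousOn C' (Icc σ₁ σ₂)) (hAc : ContinuousOn A (Icc σ₁ σ₂))
    (hf : ∀ s ∈ Icc σ₁ σ₂, HasDerivAt f (f' s) s) (hfc : ContinuousOn f (Icc σ₁ σ₂))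
    (hf'c : ContinuousOn f' (Icc σ₁ σ₂))
    (hg : ∀ᶠ k in atTop, ∀ s ∈ Icc σ₁ σ₂, HasDerivAt (g k) (g' k s) s)
    (hgc : ∀ᶠ k in atTop, ContinuousOn (g k) (Icc σ₁ σ₂) ∧ ContinuousOn (g' k) (Icc σ₁ σ₂) ∧
      ContinuousOn (Ck k) (Icc σ₁ σ₂) ∧ ContinuousOn (Ak k) (Icc σ₁ σ₂))
    (hbd : ∀ᶠ k in atTop, ∀ s ∈ Icc σ₁ σ₂,
      ‖g k s‖ ≤ Kg ∧ ‖g' k s‖ ≤ L ∧ ‖Ck k s‖ ≤ KC ∧ ‖Ak k s‖ ≤ KA)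
    (hlim : ∀ s ∈ Icc σ₁ σ₂, Tendsto (fun k => g k s) atTop (𝓝 (f s)) ∧
      Tendsto (fun k => Ck k s) atTop (𝓝 (C s)) ∧ Tendsto (fun k => Ak k s) atTop (𝓝 (A s))) :
    Tendsto (fun k => ∫ s in σ₁..σ₂, ⟪Ck k s, Ak k s - g' k s⟫) atTop
      (𝓝 (∫ s in σ₁..σ₂, ⟪C s, A s - f' s⟫)) := by
  have hI : uIcc σ₁ σ₂ = Icc σ₁ σ₂ := uIcc_of_le hσ
  have hIoc : uIoc σ₁ σ₂ ⊆ Icc σ₁ σ₂ := by rw [uIoc_of_le hσ]; exact Ioc_subset_Icc_self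
  have hmeas : ∀ {F : ℝ → ℝ}, ContinuousOn F (Icc σ₁ σ₂) →
      AEStronglyMeasurable F (volume.restrict (uIoc σ₁ σ₂)) := fun hF =>
    (hF.mono hIoc).aestronglyMeasurable measurableSet_uIoc
  have hint : ∀ {F : ℝ → ℝ}, ContinuousOn F (Icc σ₁ σ₂) → IntervalIntegrable F volume σ₁ σ₂ :=
    fun hF => (hF.mono (by rw [hI])).intervalIntegrable
  -- a bound for `C'` on the compact interval, and for `C` from the limit
  obtain ⟨M', hM'⟩ := isCompact_Icc.exists_bound_of_continuousOn hC'c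
  have hCK : ∀ s ∈ Icc σ₁ σ₂, ‖C s‖ ≤ KC := fun s hs =>
    le_of_tendsto (hlim s hs).2.1.norm (hbd.mono fun k hk => (hk s hs).2.2.1)
  -- (0) `∫ ⟪C_k, A_k⟫ → ∫ ⟪C, A⟫`
  have h0 : Tendsto (fun k => ∫ s in σ₁..σ₂, ⟪Ck k s, Ak k s⟫) atTop
      (𝓝 (∫ s in σ₁..σ₂, ⟪C s, A s⟫)) := by
    refine intervalIntegral.tendsto_integral_filter_of_dominated_convergence
      (fun _ => KC * KA) ?_ ?_ intervalIntegrable_const ?_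
    · filter_upwards [hgc] with k hk
      exact hmeas (hk.2.2.1.inner hk.2.2.2)
    · filter_upwards [hbd] with k hk
      refine Eventually.of_forall fun s hs => (norm_inner_le_norm _ _).trans ?_
      obtain ⟨-, -, h3, h4⟩ := hk s (hIoc hs)
      exact mul_le_mul h3 h4 (norm_nonneg _) ((norm_nonneg _).trans h3)
    · exact Eventually.of_forall fun s hs => (hlim s (hIoc hs)).2.1.inner (hlim s (hIoc hs)).2.2
  -- (1) `∫ ⟪C_k - C, g_k'⟫ → 0`
  have h1 : Tendsto (fun k => ∫ s in σ₁..σ₂, ⟪Ck k s - C s, g' k s⟫) atTop (𝓝 0) := by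
    have h00 : (∫ s in σ₁..σ₂, ⟪(0 : (EuclideanSpace ℝ (Fin 3))), (0 : (EuclideanSpace ℝ (Fin 3)))⟫) = 0 := by simp
    rw [← h00]
    refine intervalIntegral.tendsto_integral_filter_of_dominated_convergence
      (fun _ => (KC + KC) * L) ?_ ?_ intervalIntegrable_const ?_
    · filter_upwards [hgc] with k hk
      exact hmeas ((hk.2.2.1.sub hCc).inner hk.2.1)
    · filter_upwards [hbd] with k hk
      refine Eventually.of_forall fun s hs => ?_
      obtain ⟨-, h2, h3, -⟩ := hk s (hIoc hs)
      calc ‖⟪Ck k s - C s, g' k s⟫‖ ≤ ‖Ck k s - C s‖ * ‖g' k s‖ := norm_inner_le_norm _ _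
        _ ≤ (KC + KC) * L := mul_le_mul ((norm_sub_le _ _).trans (add_le_add h3 (hCK s (hIoc hs))))
            h2 (norm_nonneg _) (by linarith [norm_nonneg (Ck k s)])
    · refine Eventually.of_forall fun s hs => ?_
      have hz : Tendsto (fun k => Ck k s - C s) atTop (𝓝 0) := by
        simpa using (hlim s (hIoc hs)).2.1.sub_const (C s)
      have hb : ∀ᶠ k in atTop, ‖g' k s‖ ≤ L := hbd.mono fun k hk => (hk s (hIoc hs)).2.1
      rw [inner_self_eq_zero.2 rfl]
      exact squeeze_zero_norm' (hb.mono fun k hk => (norm_inner_le_norm _ _).trans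
        (mul_le_mul_of_nonneg_left hk (norm_nonneg _)))
        (by simpa using hz.norm.mul_const L)
  -- (2) `∫ ⟪C', g_k⟫ → ∫ ⟪C', f⟫`
  have h2 : Tendsto (fun k => ∫ s in σ₁..σ₂, ⟪C' s, g k s⟫) atTop
      (𝓝 (∫ s in σ₁..σ₂, ⟪C' s, f s⟫)) := by
    refine intervalIntegral.tendsto_integral_filter_of_dominated_convergence
      (fun _ => M' * Kg) ?_ ?_ intervalIntegrable_const ?_
    · filter_upwards [hgc] with k hk
      exact hmeas (hC'c.inner hk.1)
    · filter_upwards [hbd] with k hk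
      refine Eventually.of_forall fun s hs => ?_
      calc ‖⟪C' s, g k s⟫‖ ≤ ‖C' s‖ * ‖g k s‖ := norm_inner_le_norm _ _
        _ ≤ M' * Kg := mul_le_mul (hM' s (hIoc hs)) (hk s (hIoc hs)).1 (norm_nonneg _)
            ((norm_nonneg _).trans (hM' s (hIoc hs)))
    · exact Eventually.of_forall fun s hs => tendsto_const_nhds.inner (hlim s (hIoc hs)).1
  -- (3) boundary terms
  have h3 : Tendsto (fun k => ⟪C σ₂, g k σ₂⟫ - ⟪C σ₁, g k σ₁⟫) atTop
      (𝓝 (⟪C σ₂, f σ₂⟫ - ⟪C σ₁, f σ₁⟫)) :=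
    (tendsto_const_nhds.inner (hlim σ₂ (right_mem_Icc.2 hσ)).1).sub
      (tendsto_const_nhds.inner (hlim σ₁ (left_mem_Icc.2 hσ)).1)
  -- assemble through the integration by parts identities
  have heq : ∀ᶠ k in atTop, (∫ s in σ₁..σ₂, ⟪Ck k s, Ak k s⟫) -
      ((∫ s in σ₁..σ₂, ⟪Ck k s - C s, g' k s⟫) +
        ((⟪C σ₂, g k σ₂⟫ - ⟪C σ₁, g k σ₁⟫) - ∫ s in σ₁..σ₂, ⟪C' s, g k s⟫)) =
      ∫ s in σ₁..σ₂, ⟪Ck k s, Ak k s - g' k s⟫ := by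
    filter_upwards [hg, hgc] with k hk hkc
    obtain ⟨hgk, hg'k, hCk, hAk⟩ := hkc
    have hi1 : IntervalIntegrable (fun s => ⟪Ck k s - C s, g' k s⟫) volume σ₁ σ₂ :=
      hint ((hCk.sub hCc).inner hg'k)
    rw [← intervalIntegral_inner_deriv_eq hσ hC hCc hC'c hk hgk hg'k,
      ← intervalIntegral.integral_add hi1 (hint (hCc.inner hg'k)),
      ← intervalIntegral.integral_sub (hint (hCk.inner hAk)) (hi1.add (hint (hCc.inner hg'k)))]
    exact intervalIntegral.integral_congr fun s _ => by
      simp only [inner_sub_left, inner_sub_right]; ring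
  have hlimit : (∫ s in σ₁..σ₂, ⟪C s, A s⟫) - (0 + ((⟪C σ₂, f σ₂⟫ - ⟪C σ₁, f σ₁⟫) -
      ∫ s in σ₁..σ₂, ⟪C' s, f s⟫)) = ∫ s in σ₁..σ₂, ⟪C s, A s - f' s⟫ := by
    rw [zero_add, ← intervalIntegral_inner_deriv_eq hσ hC hCc hC'c hf hfc hf'c,
      ← intervalIntegral.integral_sub (hint (hCc.inner hAc)) (hint (hCc.inner hf'c))]
    exact intervalIntegral.integral_congr fun s _ => by simp only [inner_sub_right]
  rw [← hlimit]
  exact ((h0.sub (h1.add (h3.sub h2))).congr' heq)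


/-! ### The defect along time lines of a convergent sequence of classical pairs -/

/-- Time lines of jointly continuous fields are continuous. [folklore] -/
theorem continuousOn_timeLine {F : Type*} [TopologicalSpace F] {S J : Set ℝ} {Φ : ℝ → (EuclideanSpace ℝ (Fin 3)) → F}
    (h : ContinuousOn (uncurry Φ) (S ×ˢ univ)) (hJ : J ⊆ S) (y : (EuclideanSpace ℝ (Fin 3))) :
    ContinuousOn (fun s => Φ s y) J :=
  h.comp (continuous_id.prodMk continuous_const).continuousOn fun _ hs => ⟨hJ hs, mem_univ _⟩

/-- The vorticity of a jointly smooth field on an open time set is jointly smooth. [folklore] -/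
theorem isSmoothSpaceTimeOn_curl {S : Set ℝ} {u : ℝ → (EuclideanSpace ℝ (Fin 3)) → (EuclideanSpace ℝ (Fin 3))} (h : IsSmoothSpaceTimeOn S u)
    (hS : IsOpen S) : IsSmoothSpaceTimeOn S (fun t x => curl (u t) x) :=
  curlCLM.contDiff.comp_contDiffOn (h.isSmoothSpaceTimeOn_fderiv_of_isOpen hS)

/-- **The momentum equation solved for the pressure gradient** on an open time set (`ν = 1`, no
force): `∇p = Δu − (u·∇)u − ∂ₜu`, with the two-sided time derivative. [folklore] -/
theorem gradient_eq_of_classical {S : Set ℝ} (hS : IsOpen S) {u : ℝ → (EuclideanSpace ℝ (Fin 3)) → (EuclideanSpace ℝ (Fin 3))} {p : ℝ → (EuclideanSpace ℝ (Fin 3)) → ℝ}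
    (h : IsClassicalNSSolutionOn S 1 0 u p) {t : ℝ} (ht : t ∈ S) (x : (EuclideanSpace ℝ (Fin 3))) :
    gradient (p t) x = (Δ (u t)) x - convect (u t) (u t) x - deriv (fun s => u s x) t := by
  have hm := h.momentum t ht x
  rw [timeDerivWithin_eq_deriv hS ht, one_smul] at hm
  have : gradient (p t) x = (Δ (u t)) x - (deriv (fun s => u s x) t + convect (u t) (u t) x) := by
    rw [hm]; simp
  rw [this]; abel

/-- A Lipschitz bound in time bounds the time derivative of a time line. [folklore] -/
theorem norm_deriv_timeLine_le {S : Set ℝ} (hS : IsOpen S) {u : ℝ → (EuclideanSpace ℝ (Fin 3)) → (EuclideanSpace ℝ (Fin 3))}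
    (h : IsSmoothSpaceTimeOn S u) {a b L : ℝ} (hL : 0 ≤ L)
    (hlip : ∀ s ∈ Ioo a b, ∀ t ∈ Ioo a b, ∀ y, ‖u t y - u s y‖ ≤ L * |t - s|) {s : ℝ}
    (hs : s ∈ Ioo a b) (hsS : s ∈ S) (y : (EuclideanSpace ℝ (Fin 3))) : ‖deriv (fun σ => u σ y) s‖ ≤ L :=
  (h.hasDerivAt_timeLine hS hsS y).le_of_lip' hL (by
    filter_upwards [isOpen_Ioo.mem_nhds hs] with σ hσ
    rw [Real.norm_eq_abs]; exact hlip s hs σ hσ y)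

/-- **Bound for the pressure gradient of a classical pair** from bounds on `u`, `∇u`, `D²u` and
`∂ₜu` at a point (`∇p = Δu − (u·∇)u − ∂ₜu`, `‖Δu‖ ≤ 3‖D²u‖`). [folklore] -/
theorem norm_gradient_le_of_classical {S : Set ℝ} (hS : IsOpen S) {u : ℝ → (EuclideanSpace ℝ (Fin 3)) → (EuclideanSpace ℝ (Fin 3))}
    {p : ℝ → (EuclideanSpace ℝ (Fin 3)) → ℝ} (h : IsClassicalNSSolutionOn S 1 0 u p) {t : ℝ} (ht : t ∈ S) {x : (EuclideanSpace ℝ (Fin 3))}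
    {K₀ K₁ K₂ L : ℝ} (h0 : ‖u t x‖ ≤ K₀) (h1 : ‖fderiv ℝ (u t) x‖ ≤ K₁)
    (h2 : ‖iteratedFDeriv ℝ 2 (u t) x‖ ≤ K₂) (hL : ‖deriv (fun s => u s x) t‖ ≤ L) :
    ‖gradient (p t) x‖ ≤ 3 * K₂ + K₁ * K₀ + L := by
  rw [gradient_eq_of_classical hS h ht x]
  refine (norm_sub_le _ _).trans (add_le_add ((norm_sub_le _ _).trans (add_le_add
    ((norm_laplacian_le_three_mul _ _).trans (by linarith)) ?_)) hL)
  rw [convect_apply]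
  exact (ContinuousLinearMap.le_opNorm _ _).trans
    (mul_le_mul h1 h0 (norm_nonneg _) ((norm_nonneg _).trans h1))

/-- **Registered sub-goal `stub_defectLineLimit`: the isobaric defect along a time line passes
to the limit in the mean.** For classical pairs `(w_j, q_j)` (`ν = 1`, no force) on windows
`(A_j, 0) ⊇ (a, 0)` with uniform bounds on `w_j, ∇w_j, D²w_j, D³w_j` and a uniform time-Lipschitz
bound on `(a, b)`, `b ≤ 0`, converging with their gradients pointwise on the open slab to a
classical pair `(W, q_W)` on `(-∞, 0)`, and `[σ₁, σ₂] ⊂ (a, b)`: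
`∫_{σ₁}^{σ₂} ⟪curl w_j, ∇q_j⟫(s, y) ds → ∫_{σ₁}^{σ₂} ⟪curl W, ∇q_W⟫(s, y) ds` for every `y`
(`∇q = Δw − (w·∇)w − ∂ₛw`; `tendsto_laplacian_of_tendsto_fderiv`,
`tendsto_intervalIntegral_inner_sub_deriv`). [folklore] -/
theorem stub_defectLineLimit :
    ∀ (A : ℕ → ℝ) (w : ℕ → ℝ → EuclideanSpace ℝ (Fin 3) → EuclideanSpace ℝ (Fin 3))
    (q : ℕ → ℝ → EuclideanSpace ℝ (Fin 3) → ℝ)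
    (W : ℝ → EuclideanSpace ℝ (Fin 3) → EuclideanSpace ℝ (Fin 3))
    (qW : ℝ → EuclideanSpace ℝ (Fin 3) → ℝ) (a b σ₁ σ₂ K₀ K₁ K₂ K₃ L : ℝ),
    σ₁ ≤ σ₂ → a < σ₁ → σ₂ < b → b ≤ 0 → 0 ≤ L →
    (∀ᶠ j in Filter.atTop, A j ≤ a ∧
      Literature.Analysis.FluidPDE.IsClassicalNSSolutionOn (Set.Ioo (A j) 0) 1 0 (w j) (q j)) →
    (∀ᶠ j in Filter.atTop, ∀ s ∈ Set.Ioo a b, ∀ y : EuclideanSpace ℝ (Fin 3), ‖w j s y‖ ≤ K₀ ∧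
      ‖fderiv ℝ (w j s) y‖ ≤ K₁ ∧ ‖iteratedFDeriv ℝ 2 (w j s) y‖ ≤ K₂ ∧
      ‖iteratedFDeriv ℝ 3 (w j s) y‖ ≤ K₃) →
    (∀ᶠ j in Filter.atTop, ∀ s ∈ Set.Ioo a b, ∀ t ∈ Set.Ioo a b, ∀ y : EuclideanSpace ℝ (Fin 3),
      ‖w j t y - w j s y‖ ≤ L * |t - s|) →
    Literature.Analysis.FluidPDE.IsClassicalNSSolutionOn (Set.Iio 0) 1 0 W qW →
    (∀ s < 0, ∀ y : EuclideanSpace ℝ (Fin 3),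
      Filter.Tendsto (fun j => w j s y) Filter.atTop (nhds (W s y))) →
    (∀ s < 0, ∀ y : EuclideanSpace ℝ (Fin 3),
      Filter.Tendsto (fun j => fderiv ℝ (w j s) y) Filter.atTop (nhds (fderiv ℝ (W s) y))) →
    ∀ y : EuclideanSpace ℝ (Fin 3),
      Filter.Tendsto (fun j => ∫ s in σ₁..σ₂,
        ⟪Literature.Analysis.FluidPDE.curl (w j s) y, gradient (q j s) y⟫) Filter.atTop
        (nhds (∫ s in σ₁..σ₂, ⟪Literature.Analysis.FluidPDE.curl (W s) y, gradient (qW s) y⟫)) := by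
  intro A w q W qW a b σ₁ σ₂ K₀ K₁ K₂ K₃ L hσ ha hb hb0 hL0 hcl hB hLip hW hpt hptG y
  have hJab : Icc σ₁ σ₂ ⊆ Ioo a b := fun s hs => ⟨ha.trans_le hs.1, hs.2.trans_lt hb⟩
  have hJ0 : Icc σ₁ σ₂ ⊆ Iio 0 := fun s hs => (hJab hs).2.trans_le hb0
  have hO : IsOpen (Iio (0 : ℝ)) := isOpen_Iio
  have hWs := hW.smooth_velocity
  -- the limit pair along the time line through `y`
  have hWc := isSmoothSpaceTimeOn_curl hWs hO
  have hWA : IsSmoothSpaceTimeOn (Iio 0) fun t x => (Δ (W t)) x - convect (W t) (W t) x :=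
    (hWs.laplacian hO.uniqueDiffOn).sub (hWs.convect hWs hO.uniqueDiffOn)
  have key := tendsto_intervalIntegral_inner_sub_deriv hσ
    (C := fun s => curl (W s) y) (C' := fun s => deriv (fun σ => curl (W σ) y) s)
    (f := fun s => W s y) (f' := fun s => deriv (fun σ => W σ y) s)
    (A := fun s => (Δ (W s)) y - convect (W s) (W s) y)
    (Ck := fun j s => curl (w j s) y) (Ak := fun j s => (Δ (w j s)) y - convect (w j s) (w j s) y)
    (g := fun j s => w j s y) (g' := fun j s => deriv (fun σ => w j σ y) s)
    (KC := ‖curlCLM‖ * K₁) (KA := 3 * K₂ + K₁ * K₀) (Kg := K₀) (L := L)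
    (fun s hs => hWc.hasDerivAt_timeLine hO (hJ0 hs) y)
    (continuousOn_timeLine hWc.continuousOn hJ0 y)
    (continuousOn_timeLine (hWc.isSmoothSpaceTimeOn_deriv hO).continuousOn hJ0 y)
    (continuousOn_timeLine hWA.continuousOn hJ0 y)
    (fun s hs => hWs.hasDerivAt_timeLine hO (hJ0 hs) y)
    (continuousOn_timeLine hWs.continuousOn hJ0 y)
    (continuousOn_timeLine (hWs.isSmoothSpaceTimeOn_deriv hO).continuousOn hJ0 y) ?_ ?_ ?_ ?_
  · -- rewrite both integrands through the momentum equation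
    have heqW : (∫ s in σ₁..σ₂, ⟪curl (W s) y, gradient (qW s) y⟫) =
        ∫ s in σ₁..σ₂, ⟪curl (W s) y, ((Δ (W s)) y - convect (W s) (W s) y) -
          deriv (fun σ => W σ y) s⟫ :=
      intervalIntegral.integral_congr fun s hs => by
        rw [uIcc_of_le hσ] at hs
        simp only [gradient_eq_of_classical hO hW (hJ0 hs) y]
    have heq : ∀ᶠ j in atTop, (∫ s in σ₁..σ₂, ⟪curl (w j s) y, ((Δ (w j s)) y -
        convect (w j s) (w j s) y) - deriv (fun σ => w j σ y) s⟫) =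
        ∫ s in σ₁..σ₂, ⟪curl (w j s) y, gradient (q j s) y⟫ := by
      filter_upwards [hcl] with j hj
      refine intervalIntegral.integral_congr fun s hs => ?_
      rw [uIcc_of_le hσ] at hs
      simp only [gradient_eq_of_classical isOpen_Ioo hj.2 ⟨hj.1.trans_lt (hJab hs).1, hJ0 hs⟩ y]
    rw [heqW]
    exact key.congr' heq
  · -- differentiability of the time lines of `w_j`
    filter_upwards [hcl] with j hj
    exact fun s hs => hj.2.smooth_velocity.hasDerivAt_timeLine isOpen_Ioo
      ⟨hj.1.trans_lt (hJab hs).1, hJ0 hs⟩ y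
  · -- continuity of the four sequences along the time line
    filter_upwards [hcl] with j hj
    have hS : IsOpen (Ioo (A j) 0) := isOpen_Ioo
    have hJS : Icc σ₁ σ₂ ⊆ Ioo (A j) 0 := fun s hs => ⟨hj.1.trans_lt (hJab hs).1, hJ0 hs⟩
    have hws := hj.2.smooth_velocity
    exact ⟨continuousOn_timeLine hws.continuousOn hJS y,
      continuousOn_timeLine (hws.isSmoothSpaceTimeOn_deriv hS).continuousOn hJS y,
      continuousOn_timeLine (isSmoothSpaceTimeOn_curl hws hS).continuousOn hJS y,
      continuousOn_timeLine ((hws.laplacian hS.uniqueDiffOn).sub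
        (hws.convect hws hS.uniqueDiffOn)).continuousOn hJS y⟩
  · -- the uniform bounds
    filter_upwards [hcl, hB, hLip] with j hj hjB hjL
    intro s hs
    have hs' := hJab hs
    obtain ⟨h0, h1, h2, -⟩ := hjB s hs' y
    refine ⟨h0, norm_deriv_timeLine_le isOpen_Ioo hj.2.smooth_velocity hL0 hjL hs'
      ⟨hj.1.trans_lt hs'.1, hJ0 hs⟩ y, (norm_curl_le _ _).trans
      (mul_le_mul_of_nonneg_left h1 (ContinuousLinearMap.opNorm_nonneg _)),
      (norm_sub_le _ _).trans (add_le_add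
      ((norm_laplacian_le_three_mul _ _).trans (by linarith)) ?_)⟩
    rw [convect_apply]
    exact (ContinuousLinearMap.le_opNorm _ _).trans
      (mul_le_mul h1 h0 (norm_nonneg _) ((norm_nonneg _).trans h1))
  · -- the pointwise limits
    intro s hs
    have hs0 : s < 0 := hJ0 hs
    refine ⟨hpt s hs0 y, ?_, ?_⟩
    · simp only [curl_eq_curlCLM]
      exact (curlCLM.continuous.tendsto _).comp (hptG s hs0 y)
    · refine Tendsto.sub ?_ ?_
      · refine tendsto_laplacian_of_tendsto_fderiv (K₂ := K₂) (K₃ := K₃) ?_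
          ((hW.contDiff_velocity hs0).of_le (by norm_cast)) (hptG s hs0) ?_ ?_ y
        · filter_upwards [hcl] with j hj
          exact (hj.2.contDiff_velocity ⟨hj.1.trans_lt (hJab hs).1, hs0⟩).of_le (by norm_cast)
        · filter_upwards [hB] with j hjB using fun z => (hjB s (hJab hs) z).2.2.1
        · filter_upwards [hB] with j hjB using fun z => (hjB s (hJab hs) z).2.2.2
      · simp only [convect_apply]
        exact (isBoundedBilinearMap_apply.continuous.tendsto _).comp
          ((hptG s hs0 y).prodMk_nhds (hpt s hs0 y))

end Summit.NavierStokesRegularity.NavierStokesRegularity.Theorems.TubeAlternative.AnalyticPropagation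

end
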